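import Mathlib.Topology.Algebra.ClopenNhdofOne
import Literature.AnabelianGeometry.AbsoluteAnabelian.AbsTopIII.KummerFaithful
import HarnessLib

/-!
# [AbsTopIII] Def. 1.5 (a) for PROFINITE groups, and the abelian-variety clause of
# Kummer-faithfulness reduced to profiniteness of `A(k′)` (proof-only companion of `KummerFaithful.lean`)

Mochizuki, *Topics in Absolute Anabelian Geometry III*, §1, Def. 1.5 p. 32 ("(a) We have
`⋂_{N ≥ 1} N · A(k_H) = {0}`") and Rmk. 1.5.4 (i) p. 33 ("every sub-`p`-adic field `k` [...] is
Kummer-faithful"), manuscript pagination (lit key `paper:url-5493eb38cbb7`).  Cell abc-iut, FACT-LIST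
row **F-0369** `Rmk_1_5_4_i` (released «NEEDS Mattuck 1955 Thm 7» by abc-iut-f-083; torus half PROVED,
`Rmk_1_5_4_i_torally`): this file records a DIFFERENT, purely topological route to the residual
abelian-variety clause, in kernel form and with no new definition:

* `eq_one_of_forall_exists_pow_eq_of_profinite` — in a compact, totally disconnected topological group
  an element that is an `n`-th power for every `n ≥ 1` is the identity: the open normal subgroups form a
  neighbourhood basis of `1` (Mathlib `ProfiniteGrp.exist_openNormalSubgroup_sub_open_nhds_of_one`), each
  has finite index `m` (compactness), and `y ^ m ∈ N` for every `y` (`Subgroup.pow_index_mem`); so a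
  divisible element lies in every neighbourhood of `1`, i.e. (the group being `T₁` as soon as it is
  `T₀`; we assume `T2Space`) it IS `1`.  Hence `DivisibleElementsTrivial.of_profinite`: **condition (a)
  of Def. 1.5 holds for every profinite abelian group**, and it transports along abstract group
  isomorphisms (`DivisibleElementsTrivial.of_mulEquiv`).
* `IsKummerFaithful.of_isTorallyKummerFaithful_of_profinite_points` — a torally Kummer-faithful field
  `k` IS Kummer-faithful (in the tree's sense: tori + abelian varieties) as soon as, for every finite
  extension `k′` and every abelian variety `A` over `k′`, the Mordell–Weil group `A(k′)` is abstractly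
  isomorphic to SOME profinite group.  For `k′` a finite extension of `ℚ_p` this hypothesis is exactly
  what [Mattuck 1955, Ann. of Math. 62, Thm 7] delivers (`A(K) ≅ (finite) × ℤ_p^{[K:ℚ_p]·dim A}`), but it
  is also delivered WITHOUT the structure theorem by the strong topology: `A(K)` is a compact
  (`Literature.AlgebraicGeometry.Motives.compactSpace_algPoints_of_isProper`, Mumford *Red Book* I.10 /
  Conrad Prop. 2.1, §5), Hausdorff (`t2Space_algPoints_holds`), totally disconnected topological group.
  So the NEED of F-0369 at `p`-adic fields shrinks from Mattuck's theorem to «`A(K)` is a profinite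
  group in its strong topology».

HONEST FRAMING.  Nothing here proves F-0369: no Kummer-faithful field is constructed (the profiniteness
of `A(K)` is not in the tree).  All declarations are theorems; the frozen statement file is imported, not
edited.  Nothing here bears on [IUTchIII] Cor. 3.12.
-/

namespace Literature.AnabelianGeometry.AbsoluteAnabelian.AbsTopIII

universe u v

open Literature.AlgebraicGeometry.Motives

/-! ### Divisible elements of profinite groups -/

/-- **A divisible element of a profinite group is trivial.**  In a compact, Hausdorff, totally
disconnected topological group `G`, if `x` is an `n`-th power for every `n ≥ 1` then `x = 1`: for every
open normal subgroup `N` (finite index `m`), `x = y ^ m ∈ N`; the open normal subgroups form a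
neighbourhood basis of `1`, and `G` is Hausdorff.  (Condition (a) of Def. 1.5 for profinite groups,
not necessarily commutative.) [cite: MochizukiAbsTopIII2015, Def 1.5 (a) p.32] -/
theorem eq_one_of_forall_exists_pow_eq_of_profinite {G : Type v} [Group G] [TopologicalSpace G]
    [IsTopologicalGroup G] [CompactSpace G] [T2Space G] [TotallyDisconnectedSpace G] (x : G)
    (hx : ∀ n : ℕ, 0 < n → ∃ y : G, y ^ n = x) : x = 1 := by
  by_contra hne
  -- an open neighbourhood of `1` missing `x`
  obtain ⟨N, hN⟩ := ProfiniteGrp.exist_openNormalSubgroup_sub_open_nhds_of_one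
    (isOpen_compl_singleton (x := x)) (by simpa using fun h => hne h.symm)
  haveI : N.toSubgroup.FiniteIndex := N.toOpenSubgroup.finiteIndex_of_finite_quotient
  obtain ⟨y, hy⟩ := hx N.toSubgroup.index (Nat.pos_of_ne_zero Subgroup.FiniteIndex.index_ne_zero)
  have hxN : x ∈ (N : Set G) := by
    rw [← hy]
    exact N.toSubgroup.pow_index_mem y
  exact hN hxN rfl

/-- **Def. 1.5 (a) holds for every profinite abelian group**: a compact, Hausdorff, totally
disconnected topological abelian group has no non-trivial divisible element.
[cite: MochizukiAbsTopIII2015, Def 1.5 (a) p.32] -/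
theorem DivisibleElementsTrivial.of_profinite (G : Type v) [CommGroup G] [TopologicalSpace G]
    [IsTopologicalGroup G] [CompactSpace G] [T2Space G] [TotallyDisconnectedSpace G] :
    DivisibleElementsTrivial G :=
  ⟨fun x hx => eq_one_of_forall_exists_pow_eq_of_profinite x hx⟩

/-- Condition (a) of Def. 1.5 is a property of the abstract group: it transports along group
isomorphisms. [cite: MochizukiAbsTopIII2015, Def 1.5 (a) p.32] -/
theorem DivisibleElementsTrivial.of_mulEquiv {G : Type u} {H : Type v} [CommGroup G] [CommGroup H]
    (e : G ≃* H) (hH : DivisibleElementsTrivial H) : DivisibleElementsTrivial G := by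
  refine ⟨fun x hx => ?_⟩
  have h1 : e x = 1 := hH.eq_one_of_forall_exists_pow (e x) fun n hn => by
    obtain ⟨y, hy⟩ := hx n hn
    exact ⟨e y, by rw [← map_pow, hy]⟩
  simpa using congrArg e.symm h1

/-- **Def. 1.5 (a) for any abelian group abstractly isomorphic to a profinite group** (Mathlib
`ProfiniteGrp`): e.g. `(finite) × ℤ_p^d`, the shape of `A(K)` for an abelian variety over a `p`-adic
field `K` by Mattuck's theorem. [cite: MochizukiAbsTopIII2015, Def 1.5 (a) p.32] -/
theorem DivisibleElementsTrivial.of_mulEquiv_profiniteGrp {G : Type u} [CommGroup G]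
    (P : ProfiniteGrp.{v}) (e : G ≃* P) : DivisibleElementsTrivial G := by
  refine ⟨fun x hx => ?_⟩
  have h1 : e x = 1 := eq_one_of_forall_exists_pow_eq_of_profinite (e x) fun n hn => by
    obtain ⟨y, hy⟩ := hx n hn
    exact ⟨e y, by rw [← map_pow, hy]⟩
  simpa using congrArg e.symm h1

/-! ### The abelian-variety clause of Kummer-faithfulness from profiniteness of `A(k′)` -/

/-- **Kummer-faithfulness from toral Kummer-faithfulness and profiniteness of Mordell–Weil groups.**
If `k` is torally Kummer-faithful and, for every finite extension `k′` of `k` and every abelian variety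
`A` over `k′`, the group `A(k′)` is abstractly isomorphic to a profinite group, then `k` is
Kummer-faithful (tree sense: tori + abelian varieties).  For finite extensions of `ℚ_p` the hypothesis
is supplied either by [Mattuck 1955, Thm 7] or by compactness + total disconnectedness of the strong
topology on `A(k′)`; neither is in the tree, so this is a REDUCTION of FACT-LIST row F-0369's residual,
not a discharge. [cite: MochizukiAbsTopIII2015, Rmk 1.5.4 (i) p.33] -/
theorem IsKummerFaithful.of_isTorallyKummerFaithful_of_profinite_points {k : Type u} [Field k]
    (hk : IsTorallyKummerFaithful k)
    (hA : ∀ (k' : Type u) [Field k'] [Algebra k k'], Module.Finite k k' →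
      ∀ A : AbelianVariety k', ∃ P : ProfiniteGrp.{u}, Nonempty (A.Points k' ≃* P)) :
    IsKummerFaithful k := by
  refine ⟨hk, fun k' _ _ hfin A => ?_⟩
  obtain ⟨P, ⟨e⟩⟩ := hA k' hfin A
  exact DivisibleElementsTrivial.of_mulEquiv_profiniteGrp P e

/-- **The same reduction with the profinite structure given as a topology on `A(k′)` itself**: if for
every finite `k′/k` and every abelian variety `A/k′` the group `A(k′)` carries SOME topology making it a
compact, Hausdorff, totally disconnected topological group (e.g. the strong topology, once
`compactSpace_algPoints_of_isProper` and the continuity of the group law are available), then a torally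
Kummer-faithful `k` is Kummer-faithful. [cite: MochizukiAbsTopIII2015, Rmk 1.5.4 (i) p.33] -/
theorem IsKummerFaithful.of_isTorallyKummerFaithful_of_compact_totallyDisconnected {k : Type u}
    [Field k] (hk : IsTorallyKummerFaithful k)
    (hA : ∀ (k' : Type u) [Field k'] [Algebra k k'], Module.Finite k k' →
      ∀ A : AbelianVariety k', ∃ t : TopologicalSpace (A.Points k'),
        @IsTopologicalGroup (A.Points k') t _ ∧ @CompactSpace (A.Points k') t ∧
          @T2Space (A.Points k') t ∧ @TotallyDisconnectedSpace (A.Points k') t) :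
    IsKummerFaithful k := by
  refine ⟨hk, fun k' _ _ hfin A => ?_⟩
  obtain ⟨t, htg, hc, ht2, htd⟩ := hA k' hfin A
  letI : TopologicalSpace (A.Points k') := t
  exact DivisibleElementsTrivial.of_profinite (A.Points k')

/-- **F-0369 at a single field, reduced**: `Rmk_1_5_4_i`'s conclusion `IsKummerFaithful k` for ONE
sub-`p`-adic `k` follows from the profiniteness hypothesis alone (the torus half being the tree's
theorem `IsSubpadic.isTorallyKummerFaithful`, `KummerFaithfulSubpadicProofs.lean`) — stated here with
the torus half as an explicit input so that this file does not depend on that companion.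
[cite: MochizukiAbsTopIII2015, Rmk 1.5.4 (i) p.33] -/
theorem isKummerFaithful_of_profinite_points_of_torally {k : Type u} [Field k]
    (htor : IsTorallyKummerFaithful k)
    (hA : ∀ (k' : Type u) [Field k'] [Algebra k k'], Module.Finite k k' →
      ∀ A : AbelianVariety k', ∃ P : ProfiniteGrp.{u}, Nonempty (A.Points k' ≃* P)) :
    IsKummerFaithful k :=
  IsKummerFaithful.of_isTorallyKummerFaithful_of_profinite_points htor hA

end Literature.AnabelianGeometry.AbsoluteAnabelian.AbsTopIII
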